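import Literature.MathematicalPhysics.QuantumFieldTheory.Balaban1983to89.TorusReflectionPositivity
import Literature.MathematicalPhysics.QuantumFieldTheory.Balaban1983to89.T4GenFunBounds
import Literature.MathematicalPhysics.QuantumFieldTheory.LatticeGaugeProofs

/-!
# `Balaban1983to89.GibbsMeasureWilsonDictionary` — the cell's lattice Yang–Mills measure `gibbsMeasure P β` on Bałaban's `T^{(0)}`
# IS the host tree's `wilsonMeasure (fundamentalRep (Fin N)) (β/N)` on `(ℤ/Mℤ)^d`, pushed forward along `ofConfig`

Cell `ym3-torus` (HUMAN RULING D-0037), seat `ym3-torus-p2` gen 4.  Two vocabularies for ONE object: the cell's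
`T4GenFunBounds.gibbsMeasure P β = Z⁻¹e^{−βA(U)}∏dU(b)` on `GaugeField P 0 (SU(N))` (normalised trace, `A = Σ_p(1 − Re tr U(∂p))`,
[Balaban1985UV3] (1)–(2): `ρ₀ = exp[−g₀⁻²A(U)]`, expectations `Z⁻¹∫(·)ρ₀`) and the host tree's `wilsonMeasure ρ β'` on
`GaugeConfig d M G` (un-normalised trace, `S = Σ_p(N − Re Tr ρ(U_p)) = N·A`, so `β' = β/N`; `TorusReflectionPositivity` §1:
`toConfig`/`ofConfig`, `wilsonAction_toConfig`, `integral_comp_ofConfig`).  The tree has the dictionary for PROBABILITIES of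
measurable events (`T3FinestHeightTail.gibbsMeasure_real_eq_wilsonMeasure_real`, lit seat g8).  Here, once and for all:

* `integral_gibbsMeasure_eq_integral_wilsonMeasure` — for `β ≥ 0` and EVERY `F` (junk values included):
  `∫ F d(gibbsMeasure P β) = ∫ F(ofConfig V) d(wilsonMeasure (fundamentalRep (Fin N)) (β/N))(V)`;
* `map_ofConfig_wilsonMeasure` — the MEASURES agree: `(wilsonMeasure (fundamentalRep (Fin N)) (β/N)).map ofConfig = gibbsMeasure P β`.

So every host-tree theorem about `wilsonMeasure` (reflection positivity, chessboard, area law, strong coupling, …) is a theorem about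
the cell's `gibbsMeasure` / `Missing.expect` by `integral_map`.  Everything here is proved; no `Prop`-valued definitions.
-/

noncomputable section

open MeasureTheory
open scoped ENNReal

namespace Literature.MathematicalPhysics.QuantumFieldTheory.Balaban1983to89.GibbsMeasureWilsonDictionary

open Literature.MathematicalPhysics.QuantumLattice (fundamentalRep continuous_fundamentalRep)
open Missing (boltzmann partitionFn boltzmann_pos boltzmann_le_one measurable_boltzmann partitionFn_pos')

variable {N : ℕ} [NeZero N] (P : Params)

omit [NeZero N] in
/-- `SU(N)` is second countable (a subtype of the second-countable `M_N(ℂ)`). [folklore] -/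
private theorem secondCountable_SU : SecondCountableTopology (Matrix.specialUnitaryGroup (Fin N) ℂ) := by
  haveI := secondCountableTopology_matrix (n := Fin N)
  exact Topology.IsEmbedding.subtypeVal.secondCountableTopology

/-- The host Boltzmann weight at inverse coupling `β/N`, read through the dictionary, is the cell's `e^{−βA(U)}`:
`exp(−(β/N)·S(V)) = boltzmann P β (ofConfig V)` (`S = N·A`, `wilsonAction_toConfig`). [cite: Balaban1985UV3, (1)-(2) p.256] -/
theorem exp_neg_wilsonAction_eq_boltzmann (β : ℝ) (V : GaugeConfig P.d (P.sitesPerDir 0) (Matrix.specialUnitaryGroup (Fin N) ℂ)) :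
    Real.exp (-(β / N) * QuantumFieldTheory.wilsonAction (fundamentalRep (Fin N)) V) = boltzmann P β (ofConfig V) := by
  have h := wilsonAction_toConfig (j := 0) (fundamentalRep (Fin N)) reTr_mul_card_SU (ofConfig (P := P) V)
  rw [toConfig_ofConfig] at h
  rw [h, boltzmann]
  congr 1
  have hN : (N : ℝ) ≠ 0 := Nat.cast_ne_zero.mpr (NeZero.ne N)
  field_simp

/-- The host partition function at `β/N` is the cell's `Z`: `Z_{(ℤ/Mℤ)^d, β/N} = ofReal (partitionFn P β)`. [cite: Balaban1985UV3, (1)-(2) p.256] -/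
theorem partitionFunction_eq_ofReal_partitionFn {β : ℝ} (hβ : 0 ≤ β) :
    partitionFunction (d := P.d) (L := P.sitesPerDir 0) (fundamentalRep (Fin N)) (β / N) =
      ENNReal.ofReal (partitionFn (G := Matrix.specialUnitaryGroup (Fin N) ℂ) P β) := by
  set ν : Measure (GaugeConfig P.d (P.sitesPerDir 0) (Matrix.specialUnitaryGroup (Fin N) ℂ)) :=
    Measure.pi fun _ => haarProbability (Matrix.specialUnitaryGroup (Fin N) ℂ) with hν
  have hbint : Integrable (fun V : GaugeConfig P.d (P.sitesPerDir 0) (Matrix.specialUnitaryGroup (Fin N) ℂ) =>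
      boltzmann P β (ofConfig V)) ν :=
    Integrable.of_bound ((measurable_boltzmann RegularGaugeGroup.measurable_reTr P β).comp
      measurable_ofConfig).aestronglyMeasurable 1 (ae_of_all _ fun V => by
        rw [Real.norm_eq_abs, abs_of_pos (boltzmann_pos P β _)]; exact boltzmann_le_one P hβ _)
  simp only [partitionFunction, wilsonWeight, withDensity_apply _ MeasurableSet.univ, Measure.restrict_univ]
  rw [← hν]
  have h1 : ∫⁻ V, ENNReal.ofReal (Real.exp (-(β / N) * QuantumFieldTheory.wilsonAction (fundamentalRep (Fin N)) V)) ∂ν =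
      ∫⁻ V, ENNReal.ofReal (boltzmann P β (ofConfig V)) ∂ν :=
    lintegral_congr fun V => by rw [exp_neg_wilsonAction_eq_boltzmann]
  rw [h1, ← ofReal_integral_eq_lintegral_ofReal hbint (ae_of_all _ fun V => (boltzmann_pos P β _).le), partitionFn]
  congr 1
  exact integral_comp_ofConfig (P := P) (j := 0) rfl (boltzmann P β)

/-- **THE DICTIONARY FOR EXPECTATIONS**: for `β ≥ 0` and EVERY observable `F`,
`∫ F d(gibbsMeasure P β) = ∫ F(ofConfig V) d(wilsonMeasure_{(ℤ/Mℤ)^d, β/N})(V)`, `M = P.sitesPerDir 0`, `G = SU(N)` with its fundamental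
representation (both sides are `Z⁻¹∫F e^{−βA}`; the product Haar measures correspond along `ofConfig`). [cite: Balaban1985UV3, (1)-(2) p.256] -/
theorem integral_gibbsMeasure_eq_integral_wilsonMeasure {β : ℝ} (hβ : 0 ≤ β)
    (F : GaugeField P 0 (Matrix.specialUnitaryGroup (Fin N) ℂ) → ℝ) :
    ∫ U, F U ∂(T4GenFunBounds.gibbsMeasure P β) =
      ∫ V, F (ofConfig V) ∂(wilsonMeasure (d := P.d) (L := P.sitesPerDir 0) (fundamentalRep (Fin N)) (β / N)) := by
  haveI := secondCountable_SU (N := N)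
  have hρc : Continuous (fundamentalRep (Fin N)) := continuous_fundamentalRep (Fin N)
  set ν : Measure (GaugeConfig P.d (P.sitesPerDir 0) (Matrix.specialUnitaryGroup (Fin N) ℂ)) :=
    Measure.pi fun _ => haarProbability (Matrix.specialUnitaryGroup (Fin N) ℂ) with hν
  set w : GaugeConfig P.d (P.sitesPerDir 0) (Matrix.specialUnitaryGroup (Fin N) ℂ) → ℝ≥0∞ :=
    fun V => ENNReal.ofReal (Real.exp (-(β / N) * QuantumFieldTheory.wilsonAction (fundamentalRep (Fin N)) V)) with hw
  have hwm : Measurable w :=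
    (Real.measurable_exp.comp ((measurable_wilsonAction (fundamentalRep (Fin N)) hρc).const_mul _)).ennreal_ofReal
  have hZpos : 0 < partitionFn (G := Matrix.specialUnitaryGroup (Fin N) ℂ) P β := partitionFn_pos' P hβ
  rw [T4GenFunBounds.integral_gibbsMeasure P hβ F, wilsonMeasure, integral_smul_measure,
    partitionFunction_eq_ofReal_partitionFn P hβ, ENNReal.toReal_inv, ENNReal.toReal_ofReal hZpos.le, wilsonWeight, ← hν,
    integral_withDensity_eq_integral_toReal_smul hwm (ae_of_all _ fun V => ENNReal.ofReal_lt_top)]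
  have h2 : (fun V => (w V).toReal • F (ofConfig V)) = fun V => (fun U => boltzmann P β U * F U) (ofConfig V) := by
    funext V
    simp only [hw, ENNReal.toReal_ofReal (Real.exp_pos _).le, smul_eq_mul]
    rw [exp_neg_wilsonAction_eq_boltzmann]
  rw [h2, integral_comp_ofConfig (P := P) (j := 0) rfl (fun U => boltzmann P β U * F U), smul_eq_mul, div_eq_inv_mul]
  congr 1
  exact integral_congr_ae (ae_of_all _ fun U => mul_comm _ _)

/-- **THE DICTIONARY FOR MEASURES**: for `β ≥ 0`, `(wilsonMeasure (fundamentalRep (Fin N)) (β/N)).map ofConfig = gibbsMeasure P β` — the cell's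
lattice Yang–Mills measure is the push-forward of the host tree's Wilson measure along the coordinate relabelling.
[cite: Balaban1985UV3, (1)-(2) p.256] -/
theorem map_ofConfig_wilsonMeasure {β : ℝ} (hβ : 0 ≤ β) :
    (wilsonMeasure (d := P.d) (L := P.sitesPerDir 0) (fundamentalRep (Fin N)) (β / N)).map
        (ofConfig (P := P) (j := 0) (G := Matrix.specialUnitaryGroup (Fin N) ℂ)) =
      T4GenFunBounds.gibbsMeasure P β := by
  haveI := T4GenFunBounds.isProbabilityMeasure_gibbsMeasure (G := Matrix.specialUnitaryGroup (Fin N) ℂ) P hβ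
  haveI := isProbabilityMeasure_wilsonMeasure (d := P.d) (L := P.sitesPerDir 0)
    (G := Matrix.specialUnitaryGroup (Fin N) ℂ) (fundamentalRep (Fin N)) (continuous_fundamentalRep (Fin N)) (β / N)
  refine Measure.ext fun S hS => ?_
  rw [Measure.map_apply measurable_ofConfig hS]
  have h1 : (T4GenFunBounds.gibbsMeasure P β).real S =
      (wilsonMeasure (d := P.d) (L := P.sitesPerDir 0) (fundamentalRep (Fin N)) (β / N)).real (ofConfig ⁻¹' S) := by
    rw [← integral_indicator_one hS, ← integral_indicator_one (measurable_ofConfig hS),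
      integral_gibbsMeasure_eq_integral_wilsonMeasure P hβ]
    rfl
  rw [← ENNReal.ofReal_toReal (measure_ne_top _ (ofConfig ⁻¹' S)), ← ENNReal.ofReal_toReal (measure_ne_top _ S)]
  exact congrArg ENNReal.ofReal h1.symm

end Literature.MathematicalPhysics.QuantumFieldTheory.Balaban1983to89.GibbsMeasureWilsonDictionary

end
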